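import Literature.Probability.RandomPlanarGeometry.SLETraceKappaLimit
import Literature.Probability.RandomPlanarGeometry.CritPercSLESimplePathHolds
import Literature.Probability.RandomPlanarGeometry.DrivingFunctionMeasurable
import Literature.Probability.RandomPlanarGeometry.LocalMartingaleProofs
import Literature.Probability.RandomPlanarGeometry.SLERestrictionMartingale
import Literature.Probability.RandomPlanarGeometry.SLERestrictionLemmas
import Literature.Probability.RandomPlanarGeometry.LoewnerAdaptedPlane
import Literature.Probability.RandomPlanarGeometry.LoewnerMapProofs
import Literature.Probability.RandomPlanarGeometry.LoewnerChainProofs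
import Literature.Probability.RandomPlanarGeometry.LoewnerFlow
import Mathlib.MeasureTheory.Constructions.BorelSpace.Metric
import HarnessLib

/-!
# `stub_sleHeight` — points of the domain far from the SLE(8/3) reference curve are not swallowed
and sit at a definite height under the Loewner map (crux `PathUpgradeR`,
stmt-CriticalPhenomena-18055, route `SAWReversalUpgrade`, line `bidir_windows`)

Landing target:
`Summits/CriticalPhenomena/SAWScalingLimit/Theorems/SAWReversalUpgradePathUpgradeRSLEHeight.lean`
(`--supports stmt-CriticalPhenomena-18055`; registered stub `stub_sleHeight`).

The registered theorem `stub_sleHeight` is a quantile lemma for the SLE(8/3) reference sample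
`V = sleDriving (8/3) ω`, `γ = sleTrace (8/3) ω` seen in a Dobrushin domain `E` through the boundary
extension `ψ̄` of a chordal uniformizer `ψ : ℍ ≃ E` (`r = ψ̄ ∘ γ`): for every horizon `T`, every
`d' > 0` and every budget `β > 0` there is a deterministic height `h₀ > 0` such that the event
"some `e ∈ E` at distance `≥ d'` from `r[0, T + 1] ∪ ∂E` has `z = ψ⁻¹ e` swallowed by time `T` or
`im g_T(z) < h₀`" has `P'`-measure at most `β`.

Proof (sub-namespace `PathUpgradeRSLERegHeight`, general `0 < κ ≤ 4`). Almost surely the chain is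
generated by its trace and the trace is simple (Rohde–Schramm Thms. 5.1, 6.1), so
`K_T = γ(0, T]` (`IsGeneratedByCurve.hull_eq_image`). Deterministic core: a point `e ∈ E` with
`ψ̄ (γ s) ≠ e` for `s ∈ (0, T]` has `ψ⁻¹ e ∈ H_T = ℍ ∖ K_T` (`symm_mem_domain`); the set `K` of points
of `closure E` at distance `≥ c` from `∂E` and from the points `ψ̄ (γ q)`, `q ≤ T + 1` in a dense
set of times, is compact, contained in `E`, mapped by `ψ⁻¹` into the open set `H_T` on which `g_T` is
continuous with positive imaginary part, so `im g_T ∘ ψ⁻¹ ≥ δ > 0` on `K`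
(`exists_forall_le_im_map`). Measurability: the supersets
`B n := {∃ e ∈ Q', (∀ q ∈ S, q ≤ T + 1 → d'/2 < dist e (ψ̄ (γ q))) ∧ T < T_{ψ⁻¹ e} ∧
  im g_T(ψ⁻¹ e) < 1/(n+1)}` (`Q'` countable dense in the points of `E` at distance `> d'/2` from
`∂E`, `S` countable dense in time) are measurable by `measurable_sleTrace`,
`Loewner.measurableSet_lt_swallowingTime_of_im_pos` and `Loewner.measurable_map_of_im_pos`, decrease
in `n`, and have a null intersection by the deterministic core with `c = d'/2`; continuity from
above (`tendsto_measure_iInter_atTop`) gives `n` with `P' (B n) < β`, and the event of the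
statement with `h₀ = 1/(n+1)` is contained in `B n` up to the null set of bad samples (openness of
`{T < T_z}`, continuity of `g_T` and of `ψ⁻¹`, density of `Q'`). This imitates
`PathUpgradeRRangeBound.exists_measure_tail_le` and `PathUpgradeRSLERegBd`.
-/

noncomputable section

open scoped ENNReal NNReal Topology
open MeasureTheory Filter Set Metric TopologicalSpace
open Literature.Probability Literature.Probability.RandomPlanarGeometry
open UpperHalfPlane (upperHalfPlaneSet)

namespace Summit.CriticalPhenomena.SAWScalingLimit.Theorems

namespace PathUpgradeRSLERegHeight

/-! ### Deterministic core -/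

/-- For a chain generated by a simple curve `γ` and a conformal equivalence `φ : ℍ ≃ U`, a point
`e ∈ U` which is not of the form `φ̄ (γ s)` with `0 < s ≤ T` has `φ⁻¹ e` in the Loewner domain
`H_T = ℍ ∖ K_T` (`K_T = γ(0, T]`, `IsGeneratedByCurve.hull_eq_image`). [folklore] -/
theorem symm_mem_domain {U : Set ℂ} (φ : ConformalEquiv upperHalfPlaneSet U) {V : ℝ≥0 → ℝ}
    {γ : ℝ≥0 → ℂ} (hgen : Loewner.IsGeneratedByCurve V γ) (hs : Loewner.IsSimpleTrace γ)
    {T : ℝ≥0} {e : ℂ} (he : e ∈ U)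
    (hne : ∀ s : ℝ≥0, 0 < s → s ≤ T → φ.boundaryExtension (γ s) ≠ e) :
    φ.symm e ∈ Loewner.domain V T := by
  show φ.symm e ∈ upperHalfPlaneSet \ Loewner.hull V T
  refine ⟨φ.symm_mapsTo he, fun hmem ↦ ?_⟩
  rw [hgen.hull_eq_image hs T] at hmem
  obtain ⟨s, hs', hse⟩ := hmem
  refine hne s hs'.1 hs'.2 ?_
  rw [hse, φ.boundaryExtension_eq (φ.symm_mapsTo he), φ.apply_symm_apply he]

/-- **Uniform height of far points.** For a chain with continuous driving function generated by a
simple curve `γ`, a conformal equivalence `φ : ℍ ≃ D` onto a Dobrushin domain, a horizon `T`,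
`c > 0` and a dense set of times `S`: there is `δ > 0` such that every point `e` of `closure D` at
distance `≥ c` from `∂D` and from all `φ̄ (γ q)`, `q ∈ S`, `q ≤ T + 1`, has `φ⁻¹ e` not swallowed
by time `T` and `im g_T(φ⁻¹ e) ≥ δ`. The set of such `e` is compact and contained in `D`, `φ⁻¹`
maps it continuously into the open set `{T < T_z}` on which `g_T` is continuous with positive
imaginary part. [folklore] -/
theorem exists_forall_le_im_map {D : DobrushinDomain}
    (φ : ConformalEquiv upperHalfPlaneSet D.carrier) {V : ℝ≥0 → ℝ} {γ : ℝ≥0 → ℂ}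
    (hV : Continuous V) (hgen : Loewner.IsGeneratedByCurve V γ) (hs : Loewner.IsSimpleTrace γ)
    (T : ℝ≥0) {c : ℝ} (hc : 0 < c) {S : Set ℝ≥0} (hSd : Dense S) :
    ∃ δ : ℝ, 0 < δ ∧ ∀ e ∈ closure D.carrier, c ≤ infDist e (frontier D.carrier) →
      (∀ q ∈ S, q ≤ T + 1 → c ≤ dist e (φ.boundaryExtension (γ q))) →
      (T : WithTop ℝ≥0) < Loewner.swallowingTime V (φ.symm e) ∧
        δ ≤ (Loewner.map V T (φ.symm e)).im := by
  have hΦc : Continuous fun z ↦ φ.boundaryExtension (Loewner.liftIm 0 z) :=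
    continuous_boundaryExtension_liftIm φ
  have hΦeq : ∀ q, φ.boundaryExtension (Loewner.liftIm 0 (γ q)) = φ.boundaryExtension (γ q) :=
    fun q ↦ by rw [Loewner.liftIm_of_le (hgen.im_nonneg q)]
  obtain ⟨K, hKmem⟩ : ∃ K : Set ℂ, ∀ e, e ∈ K ↔ e ∈ closure D.carrier ∧
      c ≤ infDist e (frontier D.carrier) ∧
      ∀ q ∈ S, q ≤ T + 1 → c ≤ dist e (φ.boundaryExtension (γ q)) :=
    ⟨{e | e ∈ closure D.carrier ∧ c ≤ infDist e (frontier D.carrier) ∧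
      ∀ q ∈ S, q ≤ T + 1 → c ≤ dist e (φ.boundaryExtension (γ q))}, fun _ ↦ Iff.rfl⟩
  have hKeq : K = closure D.carrier ∩ ({e | c ≤ infDist e (frontier D.carrier)} ∩
      ⋂ q ∈ {q ∈ S | q ≤ T + 1}, {e | c ≤ dist e (φ.boundaryExtension (γ q))}) := by
    ext e
    simp only [hKmem, mem_inter_iff, mem_setOf_eq, mem_iInter, and_imp]
  have hKclosed : IsClosed K := by
    rw [hKeq]
    exact isClosed_closure.inter ((isClosed_le continuous_const (continuous_infDist_pt _)).inter
      (isClosed_biInter fun q _ ↦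
        isClosed_le continuous_const (continuous_id.dist continuous_const)))
  have hKc : IsCompact K :=
    D.isBounded.isCompact_closure.of_isClosed_subset hKclosed fun e he ↦ ((hKmem e).1 he).1
  have hKD : K ⊆ D.carrier := by
    intro e he
    obtain ⟨hcl, hef, -⟩ := (hKmem e).1 he
    rw [closure_eq_self_union_frontier] at hcl
    rcases hcl with h | h
    · exact h
    · rw [infDist_zero_of_mem h] at hef
      exact absurd hef (not_le.2 hc)
  -- points of `K` are not swallowed by time `T`
  have hKdom : ∀ e ∈ K, φ.symm e ∈ Loewner.domain V T := by
    intro e he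
    refine symm_mem_domain φ hgen hs (hKD he) fun s _ hsT hse ↦ ?_
    have hopen : IsOpen ({q : ℝ≥0 |
        dist e (φ.boundaryExtension (Loewner.liftIm 0 (γ q))) < c} ∩ Iio (T + 1)) :=
      (isOpen_lt (continuous_const.dist (hΦc.comp hgen.continuous)) continuous_const).inter
        isOpen_Iio
    obtain ⟨q, hqS, hq1, hq2⟩ := hSd.exists_mem_open hopen
      ⟨s, by rw [mem_setOf_eq, hΦeq, hse, dist_self]; exact hc, hsT.trans_lt (lt_add_one T)⟩
    rw [mem_setOf_eq, hΦeq] at hq1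
    exact (not_le.2 hq1) (((hKmem e).1 he).2.2 q hqS (mem_Iio.1 hq2).le)
  have hcont : ContinuousOn (fun e ↦ (Loewner.map V T (φ.symm e)).im) K := by
    intro e he
    have h1 : ContinuousAt φ.symm e :=
      φ.symm.continuousOn.continuousAt (D.isOpen.mem_nhds (hKD he))
    have h2 : ContinuousAt (Loewner.map V T) (φ.symm e) :=
      Loewner.continuousAt_map hV ((Loewner.mem_domain_iff V T _).1 (hKdom e he)).2
    exact (Complex.continuous_im.continuousAt.comp (h2.comp h1)).continuousWithinAt
  have hpos : ∀ e ∈ K, 0 < (Loewner.map V T (φ.symm e)).im := fun e he ↦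
    Loewner.mapsTo_map hV T (hKdom e he)
  obtain ⟨δ, hδ0, hδ⟩ := hKc.exists_forall_le' hcont hpos
  refine ⟨δ, hδ0, fun e hecl hef heq ↦ ?_⟩
  have he : e ∈ K := (hKmem e).2 ⟨hecl, hef, heq⟩
  exact ⟨((Loewner.mem_domain_iff V T _).1 (hKdom e he)).2, hδ e he⟩

/-! ### The quantile lemma -/

/-- The SLE height quantile, general `0 < κ ≤ 4`: for a conformal equivalence `φ : ℍ ≃ D` onto a
Dobrushin domain, a horizon `T`, `d' > 0` and `β > 0`, some `h₀ > 0` has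
`P' {∃ e ∈ D, d' ≤ infDist e (φ̄ (γ[0, T + 1]) ∪ ∂D) ∧ ¬ (T < T_{φ⁻¹ e} ∧ h₀ ≤ im g_T(φ⁻¹ e))} ≤ β`.
Almost surely the trace is simple and generates the chain; the measurable supersets `B n` (see the
module docstring) decrease to a null set by `exists_forall_le_im_map`, and the event with
`h₀ = 1/(n+1)` lies in `B n` up to a null set. [folklore] -/
theorem exists_measure_height_le {κ : ℝ≥0} (h0 : 0 < κ) (h4 : κ ≤ 4) {D : DobrushinDomain}
    (φ : ConformalEquiv upperHalfPlaneSet D.carrier) (T : ℝ≥0) {d' : ℝ} (hd' : 0 < d')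
    {β : ℝ≥0∞} (hβ : 0 < β) :
    ∃ h₀ : ℝ, 0 < h₀ ∧ Process.preWienerMeasure {ω | ∃ e ∈ D.carrier,
      d' ≤ infDist e ((fun v ↦ φ.boundaryExtension (sleTrace κ ω v)) '' Icc 0 (T + 1) ∪
        frontier D.carrier) ∧
      ¬ ((T : WithTop ℝ≥0) < Loewner.swallowingTime (sleDriving κ ω) (φ.symm e) ∧
        h₀ ≤ (Loewner.map (sleDriving κ ω) T (φ.symm e)).im)} ≤ β := by
  haveI : IsProbabilityMeasure Process.preWienerMeasure := isProbabilityMeasure_preWienerMeasure'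
  have hκ8 : κ ≠ 8 := by
    intro h
    rw [h] at h4
    norm_num at h4
  have hgen := ae_isGeneratedByCurve_sleTrace (hasSLETrace_of_ne_eight_holds hκ8)
  have hsimple := ae_isSimpleTrace_sleTrace_of_le_four_apply h0 h4
  have hΦc : Continuous fun z ↦ φ.boundaryExtension (Loewner.liftIm 0 z) :=
    continuous_boundaryExtension_liftIm φ
  have hΦeq : ∀ (ω : ℝ≥0 → ℝ) (t : ℝ≥0), φ.boundaryExtension (Loewner.liftIm 0 (sleTrace κ ω t)) =
      φ.boundaryExtension (sleTrace κ ω t) := fun ω t ↦ by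
    rw [Loewner.liftIm_of_le (sleTrace_im_nonneg κ ω t)]
  have hfm : ∀ (e : ℂ) (q : ℝ≥0), Measurable fun ω : ℝ≥0 → ℝ ↦
      dist e (φ.boundaryExtension (Loewner.liftIm 0 (sleTrace κ ω q))) := fun e q ↦
    measurable_const.dist (hΦc.measurable.comp (measurable_sleTrace κ q))
  obtain ⟨S, hSc, hSd⟩ := TopologicalSpace.exists_countable_dense ℝ≥0
  obtain ⟨Q, hQc, hQd⟩ := TopologicalSpace.exists_countable_dense ℂ
  -- the countable set of test points: dense points of `D` far from `∂D`
  obtain ⟨Q', hQ'mem⟩ : ∃ Q' : Set ℂ, ∀ e, e ∈ Q' ↔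
      e ∈ Q ∧ e ∈ D.carrier ∧ d' / 2 < infDist e (frontier D.carrier) :=
    ⟨{e | e ∈ Q ∧ e ∈ D.carrier ∧ d' / 2 < infDist e (frontier D.carrier)}, fun _ ↦ Iff.rfl⟩
  have hQ'c : Q'.Countable := hQc.mono fun e he ↦ ((hQ'mem e).1 he).1
  have him : ∀ e ∈ Q', 0 < (φ.symm e).im := fun e he ↦ φ.symm_mapsTo ((hQ'mem e).1 he).2.1
  obtain ⟨B, hBmem⟩ : ∃ B : ℕ → Set (ℝ≥0 → ℝ), ∀ n ω, ω ∈ B n ↔ ∃ e ∈ Q',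
      (∀ q ∈ S, q ≤ T + 1 →
        d' / 2 < dist e (φ.boundaryExtension (Loewner.liftIm 0 (sleTrace κ ω q)))) ∧
      (T : WithTop ℝ≥0) < Loewner.swallowingTime (sleDriving κ ω) (φ.symm e) ∧
      (Loewner.map (sleDriving κ ω) T (φ.symm e)).im < 1 / ((n : ℝ) + 1) :=
    ⟨fun n ↦ {ω | ∃ e ∈ Q', (∀ q ∈ S, q ≤ T + 1 →
        d' / 2 < dist e (φ.boundaryExtension (Loewner.liftIm 0 (sleTrace κ ω q)))) ∧
      (T : WithTop ℝ≥0) < Loewner.swallowingTime (sleDriving κ ω) (φ.symm e) ∧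
      (Loewner.map (sleDriving κ ω) T (φ.symm e)).im < 1 / ((n : ℝ) + 1)}, fun _ _ ↦ Iff.rfl⟩
  -- measurability of the supersets
  have hmS : ∀ e, MeasurableSet {ω : ℝ≥0 → ℝ | ∀ q ∈ S, q ≤ T + 1 →
      d' / 2 < dist e (φ.boundaryExtension (Loewner.liftIm 0 (sleTrace κ ω q)))} := by
    intro e
    have hrep : {ω : ℝ≥0 → ℝ | ∀ q ∈ S, q ≤ T + 1 →
        d' / 2 < dist e (φ.boundaryExtension (Loewner.liftIm 0 (sleTrace κ ω q)))} =
        ⋂ q ∈ {q ∈ S | q ≤ T + 1},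
          {ω | d' / 2 < dist e (φ.boundaryExtension (Loewner.liftIm 0 (sleTrace κ ω q)))} := by
      ext ω
      simp only [mem_setOf_eq, mem_iInter, and_imp]
    rw [hrep]
    exact MeasurableSet.biInter (hSc.mono (sep_subset _ _))
      fun q _ ↦ measurableSet_lt measurable_const (hfm e q)
  have hmT : ∀ e ∈ Q', MeasurableSet {ω : ℝ≥0 → ℝ |
      (T : WithTop ℝ≥0) < Loewner.swallowingTime (sleDriving κ ω) (φ.symm e)} := fun e he ↦
    Loewner.measurableSet_lt_swallowingTime_of_im_pos (W := sleDriving κ)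
      (continuous_sleDriving κ) (fun s _ ↦ measurable_sleDriving κ s) (him e he)
  have hmM : ∀ e ∈ Q', Measurable fun ω : ℝ≥0 → ℝ ↦
      (Loewner.map (sleDriving κ ω) T (φ.symm e)).im := fun e he ↦
    Complex.continuous_im.measurable.comp (Loewner.measurable_map_of_im_pos (W := sleDriving κ)
      (continuous_sleDriving κ) (fun s _ ↦ measurable_sleDriving κ s) (him e he))
  have hBm : ∀ n, MeasurableSet (B n) := by
    intro n
    have hrep : B n = ⋃ e ∈ Q', ({ω : ℝ≥0 → ℝ | ∀ q ∈ S, q ≤ T + 1 →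
        d' / 2 < dist e (φ.boundaryExtension (Loewner.liftIm 0 (sleTrace κ ω q)))} ∩
        ({ω | (T : WithTop ℝ≥0) < Loewner.swallowingTime (sleDriving κ ω) (φ.symm e)} ∩
          {ω | (Loewner.map (sleDriving κ ω) T (φ.symm e)).im < 1 / ((n : ℝ) + 1)})) := by
      ext ω
      simp only [hBmem, mem_iUnion, mem_inter_iff, mem_setOf_eq, exists_prop]
    rw [hrep]
    exact MeasurableSet.biUnion hQ'c fun e he ↦
      (hmS e).inter ((hmT e he).inter (measurableSet_lt (hmM e he) measurable_const))
  have hanti : Antitone B := fun n n' hnn' ω hω ↦ by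
    obtain ⟨e, heQ, h1, h2, h3⟩ := (hBmem n' ω).1 hω
    exact (hBmem n ω).2 ⟨e, heQ, h1, h2, h3.trans_le (Nat.one_div_le_one_div hnn')⟩
  -- the supersets decrease to a null set
  have hnull : Process.preWienerMeasure (⋂ n, B n) = 0 := by
    rw [measure_eq_zero_iff_ae_notMem]
    filter_upwards [hsimple, hgen] with ω hωs hωg hmem
    obtain ⟨δ, hδ0, hδ⟩ :=
      exists_forall_le_im_map φ (continuous_sleDriving κ ω) hωg hωs T (half_pos hd') hSd
    obtain ⟨n, hn⟩ := exists_nat_one_div_lt hδ0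
    obtain ⟨e, heQ, h1, -, h3⟩ := (hBmem n ω).1 (mem_iInter.1 hmem n)
    obtain ⟨-, heD, hef⟩ := (hQ'mem e).1 heQ
    have h1' : ∀ q ∈ S, q ≤ T + 1 → d' / 2 ≤ dist e (φ.boundaryExtension (sleTrace κ ω q)) :=
      fun q hq hqT ↦ by rw [← hΦeq]; exact (h1 q hq hqT).le
    have key := (hδ e (subset_closure heD) hef.le h1').2
    linarith
  have htend := tendsto_measure_iInter_atTop (μ := Process.preWienerMeasure)
    (fun n ↦ (hBm n).nullMeasurableSet) hanti ⟨0, measure_ne_top _ _⟩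
  rw [hnull] at htend
  obtain ⟨n, hn⟩ := (htend.eventually_lt_const hβ).exists
  -- the null set of bad samples
  obtain ⟨N, hNmem⟩ : ∃ N : Set (ℝ≥0 → ℝ), ∀ ω, ω ∈ N ↔ ¬ (Loewner.IsSimpleTrace (sleTrace κ ω) ∧
      Loewner.IsGeneratedByCurve (sleDriving κ ω) (sleTrace κ ω)) :=
    ⟨{ω | ¬ (Loewner.IsSimpleTrace (sleTrace κ ω) ∧
      Loewner.IsGeneratedByCurve (sleDriving κ ω) (sleTrace κ ω))}, fun _ ↦ Iff.rfl⟩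
  have hNnull : Process.preWienerMeasure N = 0 := by
    have h := ae_iff.1 (hsimple.and hgen)
    rwa [show {ω | ¬ (Loewner.IsSimpleTrace (sleTrace κ ω) ∧
      Loewner.IsGeneratedByCurve (sleDriving κ ω) (sleTrace κ ω))} = N from
        Set.ext fun ω ↦ (hNmem ω).symm] at h
  refine ⟨1 / ((n : ℝ) + 1), Nat.one_div_pos_of_nat,
    le_trans (measure_mono (t := B n ∪ N) fun ω hω ↦ ?_) ?_⟩
  swap
  · calc Process.preWienerMeasure (B n ∪ N)
        ≤ Process.preWienerMeasure (B n) + Process.preWienerMeasure N := measure_union_le _ _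
      _ ≤ β := by rw [hNnull, add_zero]; exact hn.le
  -- the event of the statement is contained in `B n ∪ N`
  obtain ⟨e, heD, hfar, hneg⟩ := hω
  by_cases hgood : Loewner.IsSimpleTrace (sleTrace κ ω) ∧
    Loewner.IsGeneratedByCurve (sleDriving κ ω) (sleTrace κ ω)
  swap
  · exact Or.inr ((hNmem ω).2 hgood)
  refine Or.inl ((hBmem n ω).2 ?_)
  obtain ⟨hωs, hωg⟩ := hgood
  have hV := continuous_sleDriving κ ω
  have hRdist : ∀ v : ℝ≥0, v ≤ T + 1 → d' ≤ dist e (φ.boundaryExtension (sleTrace κ ω v)) :=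
    fun v hv ↦ hfar.trans (infDist_le_dist_of_mem (mem_union_left _ ⟨v, ⟨zero_le, hv⟩, rfl⟩))
  have hFdist : d' ≤ infDist e (frontier D.carrier) :=
    hfar.trans (infDist_le_infDist_of_subset subset_union_right ⟨_, D.boundary_mem_frontier 0⟩)
  have hdom : φ.symm e ∈ Loewner.domain (sleDriving κ ω) T := by
    refine symm_mem_domain φ hωg hωs heD fun s _ hsT hse ↦ ?_
    have h := hRdist s (hsT.trans (le_add_of_nonneg_right zero_le_one))
    rw [hse, dist_self] at h
    exact absurd h (not_le.2 hd')
  have hlt : (T : WithTop ℝ≥0) < Loewner.swallowingTime (sleDriving κ ω) (φ.symm e) :=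
    ((Loewner.mem_domain_iff _ T _).1 hdom).2
  have hsmall : (Loewner.map (sleDriving κ ω) T (φ.symm e)).im < 1 / ((n : ℝ) + 1) :=
    not_le.1 fun h ↦ hneg ⟨hlt, h⟩
  -- a neighbourhood of `e` on which "not swallowed, small height" persists
  have hN1 : {w : ℂ | (T : WithTop ℝ≥0) < Loewner.swallowingTime (sleDriving κ ω) w ∧
      (Loewner.map (sleDriving κ ω) T w).im < 1 / ((n : ℝ) + 1)} ∈ 𝓝 (φ.symm e) :=
    inter_mem ((Loewner.isOpen_setOf_lt_swallowingTime hV T).mem_nhds hlt)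
      ((Complex.continuous_im.continuousAt.comp (Loewner.continuousAt_map hV hlt)).preimage_mem_nhds
        (isOpen_Iio.mem_nhds hsmall))
  have hsymm : ContinuousAt φ.symm e :=
    φ.symm.continuousOn.continuousAt (D.isOpen.mem_nhds heD)
  obtain ⟨e', he'Q, he'D, he'd, he'T, he'M⟩ := hQd.inter_nhds_nonempty
    (inter_mem (D.isOpen.mem_nhds heD) (inter_mem (ball_mem_nhds e (half_pos hd'))
      (hsymm.preimage_mem_nhds hN1)))
  have he'd' : dist e e' < d' / 2 := by rw [dist_comm]; exact he'd
  refine ⟨e', (hQ'mem e').2 ⟨he'Q, he'D, ?_⟩, fun q _ hqT ↦ ?_, he'T, he'M⟩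
  · have h := infDist_le_infDist_add_dist (x := e) (y := e') (s := frontier D.carrier)
    linarith
  · rw [hΦeq]
    have h1 := hRdist q hqT
    have h2 := dist_triangle e e' (φ.boundaryExtension (sleTrace κ ω q))
    linarith

end PathUpgradeRSLERegHeight

/-- **SLE height quantile** (registered stub `stub_sleHeight` of line `bidir_windows`): for the
SLE(8/3) reference sample seen in the Dobrushin domain `E` through the boundary extension of a
chordal uniformizer `ψ`, every horizon `T > 0`, every `d' > 0` and every budget `β > 0` admit a
deterministic `h₀ > 0` such that, outside an event of `P'`-measure `≤ β`, every point `e ∈ E` at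
distance `≥ d'` from `ψ̄ (γ[0, T + 1]) ∪ ∂E` has `ψ⁻¹ e` not swallowed by time `T` and
`im g_T(ψ⁻¹ e) ≥ h₀` (a.s. simple generating trace for `κ = 8/3 ≤ 4`, compactness, continuity from
above). [folklore] -/
theorem stub_sleHeight : ∀ (E : Literature.Probability.RandomPlanarGeometry.DobrushinDomain) (ψ : Literature.Probability.RandomPlanarGeometry.ConformalEquiv UpperHalfPlane.upperHalfPlaneSet E.carrier), E.IsChordalUniformizing ψ → ∀ (T : NNReal), 0 < T → ∀ (d' : ℝ), 0 < d' → ∀ β : ENNReal, 0 < β → ∃ h₀ : ℝ, 0 < h₀ ∧ Literature.Probability.Process.preWienerMeasure {ω | ∃ e ∈ E.carrier, d' ≤ Metric.infDist e ((fun v => ψ.boundaryExtension (Literature.Probability.RandomPlanarGeometry.sleTrace ((8:NNReal)/3) ω v)) '' Set.Icc 0 (T + 1) ∪ frontier E.carrier) ∧ ¬ (((T : NNReal) : WithTop NNReal) < Literature.Probability.RandomPlanarGeometry.Loewner.swallowingTime (Literature.Probability.RandomPlanarGeometry.sleDriving ((8:NNReal)/3) ω) (ψ.symm e) ∧ h₀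 ≤ (Literature.Probability.RandomPlanarGeometry.Loewner.map (Literature.Probability.RandomPlanarGeometry.sleDriving ((8:NNReal)/3) ω) T (ψ.symm e)).im)} ≤ β := by
  intro E ψ _ T _ d' hd' β hβ
  have hκ0 : (0 : ℝ≥0) < 8 / 3 := by positivity
  have hκ4 : (8 : ℝ≥0) / 3 ≤ 4 := by
    rw [div_le_iff₀ (by norm_num : (0 : ℝ≥0) < 3)]
    norm_num
  exact PathUpgradeRSLERegHeight.exists_measure_height_le hκ0 hκ4 ψ T hd' hβ

end Summit.CriticalPhenomena.SAWScalingLimit.Theorems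

end
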